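import Mathlib.LinearAlgebra.Matrix.Hermitian
import Mathlib.Analysis.Normed.Algebra.MatrixExponential
import Mathlib.Analysis.SpecialFunctions.Trigonometric.DerivHyp
import Mathlib.Analysis.SpecialFunctions.Trigonometric.Series
import Mathlib.Analysis.Complex.ExponentialBounds
import Summits.QuantumFields.QCD.Theses.HeatSlicedQuarks
import Summits.QuantumFields.QCD.Theorems.HeatSlicedQuarksDaviesGaffneyWilsonSemigroup
import Summits.QuantumFields.QCD.Theorems.HeatSlicedQuarksDaviesGaffneyWilsonRange

/-!
# U-uniform Davies–Gaffney bound for the Wilson heat kernel (stmt-QuantumFields-8873)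

Support `DaviesGaffneyWilson` of route `QuantumFields/QCD/HeatSlicedQuarks`:
`DaviesGaffneyWilson_proof` gives `C = 1`, `c = 1/(72·101²)` with
`|e^{−t D_W†D_W}((x,a,α),(y,b,β))| ≤ C·exp(−c·d²/(t+d))`, `d = torusDist x y`, for every torus side,
every `SU(3)` link field, every `m ∈ [−1,1]`, `t ≥ 0`.  Method: Davies' exponential weights (Davies 1993,
Carne–Varopoulos) — conjugating the positive finite-range matrix `A = D†D` by `diag(e^{λ d(·,y)})`
changes its Hermitian part only at second order, `(cosh(θ_i−θ_j) − 1)A_{ij}` (`re_quadForm_weight_conj_ge`),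
so the Lumer–Phillips bound (`…Semigroup`) gives `|e^{−tA}(x,y)| ≤ exp(−λd + t h (cosh λR − 1))`
(`davies_exp_entry_bound`); `λ = a·d/(t+d)` and `cosh 2λ − 1 ≤ 18λ²` give the crossover
(`davies_exponent_le`); range `2` and row sums `≤ 101²` of `|D_W†D_W|`, uniform in `U`, come from
`…Range`.  No named facts are used (unconditional).
-/

noncomputable section

namespace Summit.QuantumFields.QCD.Theorems.HeatSlicedQuarksDaviesGaffney

open scoped InnerProductSpace ComplexConjugate Matrix
open NormedSpace

section Weighted

variable {ι : Type*} [Fintype ι] [DecidableEq ι]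

/-- The exponential weights `W_θ = diag(e^{θ_i})` satisfy `W_θ W_{-θ} = 1`. -/
theorem weight_mul_weight_neg (θ : ι → ℝ) :
    (Matrix.diagonal fun i => ((Real.exp (θ i) : ℝ) : ℂ)) *
      (Matrix.diagonal fun i => ((Real.exp (-θ i) : ℝ) : ℂ)) = 1 := by
  rw [Matrix.diagonal_mul_diagonal, ← Matrix.diagonal_one]
  congr 1
  funext i
  rw [← Complex.ofReal_mul, ← Real.exp_add, add_neg_cancel, Real.exp_zero, Complex.ofReal_one]

/-- The exponential weights `W_θ = diag(e^{θ_i})` satisfy `W_{-θ} W_θ = 1`. -/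
theorem weight_neg_mul_weight (θ : ι → ℝ) :
    (Matrix.diagonal fun i => ((Real.exp (-θ i) : ℝ) : ℂ)) *
      (Matrix.diagonal fun i => ((Real.exp (θ i) : ℝ) : ℂ)) = 1 := by
  rw [Matrix.diagonal_mul_diagonal, ← Matrix.diagonal_one]
  congr 1
  funext i
  rw [← Complex.ofReal_mul, ← Real.exp_add, neg_add_cancel, Real.exp_zero, Complex.ofReal_one]

/-- Entries of the conjugated matrix: `(W_θ A W_{-θ})_{ij} = e^{θ_i - θ_j} A_{ij}`. -/
theorem weight_mul_mul_weight_apply (θ : ι → ℝ) (A : Matrix ι ι ℂ) (i j : ι) :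
    ((Matrix.diagonal fun i => ((Real.exp (θ i) : ℝ) : ℂ)) * A *
        (Matrix.diagonal fun i => ((Real.exp (-θ i) : ℝ) : ℂ))) i j =
      ((Real.exp (θ i - θ j) : ℝ) : ℂ) * A i j := by
  rw [Matrix.mul_diagonal, Matrix.diagonal_mul, Real.exp_sub, div_eq_mul_inv, ← Real.exp_neg,
    Complex.ofReal_mul]
  ring


/-- **Weighted numerical range (Davies).**  Let `A` be Hermitian with `Re(v† A v) ≥ 0`, and let
`θ : ι → ℝ`.  If every row sum `Σ_j (cosh(θ_i − θ_j) − 1)‖A_{ij}‖` is at most `β`, then the conjugated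
matrix `W_θ A W_{−θ}` satisfies `Re(v† W_θ A W_{−θ} v) ≥ −β Σ_i |v_i|²`.  The point is the
symmetrisation `Re Σ e^{θ_i−θ_j} v̄_i A_{ij} v_j = Σ cosh(θ_i−θ_j) Re(v̄_i A_{ij} v_j)`, which kills the
first-order term in `θ`. -/
theorem re_quadForm_weight_conj_ge {A : Matrix ι ι ℂ} (hA : A.IsHermitian)
    (hpos : ∀ v : ι → ℂ, 0 ≤ (star v ⬝ᵥ A.mulVec v).re) (θ : ι → ℝ) {β : ℝ}
    (hβ : ∀ i, ∑ j, (Real.cosh (θ i - θ j) - 1) * ‖A i j‖ ≤ β) (v : ι → ℂ) :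
    -(β * ∑ i, ‖v i‖ ^ 2) ≤
      (star v ⬝ᵥ ((Matrix.diagonal fun i => ((Real.exp (θ i) : ℝ) : ℂ)) * A *
        (Matrix.diagonal fun i => ((Real.exp (-θ i) : ℝ) : ℂ))).mulVec v).re := by
  set q : ι → ι → ℝ := fun i j => (star (v i) * A i j * v j).re with hq_def
  have hq_symm : ∀ i j, q j i = q i j := fun i j => re_term_symm hA v i j
  -- the weighted form is `Σ e^{θ_i - θ_j} q_{ij}`
  have h1 : (star v ⬝ᵥ ((Matrix.diagonal fun i => ((Real.exp (θ i) : ℝ) : ℂ)) * A *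
        (Matrix.diagonal fun i => ((Real.exp (-θ i) : ℝ) : ℂ))).mulVec v).re =
      ∑ i, ∑ j, Real.exp (θ i - θ j) * q i j := by
    rw [star_dotProduct_mulVec_eq_sum, Complex.re_sum]
    refine Finset.sum_congr rfl fun i _ => ?_
    rw [Complex.re_sum]
    refine Finset.sum_congr rfl fun j _ => ?_
    rw [weight_mul_mul_weight_apply]
    have : star (v i) * (((Real.exp (θ i - θ j) : ℝ) : ℂ) * A i j) * v j =
        ((Real.exp (θ i - θ j) : ℝ) : ℂ) * (star (v i) * A i j * v j) := by ring
    rw [this, Complex.re_ofReal_mul]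
  -- symmetrisation
  have hswap : ∑ i, ∑ j, Real.exp (θ i - θ j) * q i j = ∑ i, ∑ j, Real.exp (θ j - θ i) * q i j := by
    rw [Finset.sum_comm]
    exact Finset.sum_congr rfl fun i _ => Finset.sum_congr rfl fun j _ => by rw [hq_symm]
  have h2' : 2 * ∑ i, ∑ j, Real.cosh (θ i - θ j) * q i j =
      ∑ i, ∑ j, Real.exp (θ i - θ j) * q i j + ∑ i, ∑ j, Real.exp (θ j - θ i) * q i j := by
    rw [← Finset.sum_add_distrib, Finset.mul_sum]
    refine Finset.sum_congr rfl fun i _ => ?_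
    rw [← Finset.sum_add_distrib, Finset.mul_sum]
    refine Finset.sum_congr rfl fun j _ => ?_
    rw [Real.cosh_eq, neg_sub]; ring
  have h2 : ∑ i, ∑ j, Real.exp (θ i - θ j) * q i j = ∑ i, ∑ j, Real.cosh (θ i - θ j) * q i j := by
    linarith [hswap, h2']
  -- split `cosh = 1 + (cosh - 1)`
  have h3 : ∑ i, ∑ j, Real.cosh (θ i - θ j) * q i j =
      ∑ i, ∑ j, q i j + ∑ i, ∑ j, (Real.cosh (θ i - θ j) - 1) * q i j := by
    rw [← Finset.sum_add_distrib]
    refine Finset.sum_congr rfl fun i _ => ?_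
    rw [← Finset.sum_add_distrib]
    exact Finset.sum_congr rfl fun j _ => by ring
  have h4 : 0 ≤ ∑ i, ∑ j, q i j := by
    have := hpos v
    rw [star_dotProduct_mulVec_eq_sum, Complex.re_sum] at this
    simpa only [Complex.re_sum] using this
  -- the second-order remainder
  have hb_nonneg : ∀ i j, 0 ≤ (Real.cosh (θ i - θ j) - 1) * ‖A i j‖ := fun i j =>
    mul_nonneg (by linarith [Real.one_le_cosh (θ i - θ j)]) (norm_nonneg _)
  have hcol : ∀ j, ∑ i, (Real.cosh (θ i - θ j) - 1) * ‖A i j‖ ≤ β := by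
    intro j
    refine le_of_eq_of_le (Finset.sum_congr rfl fun i _ => ?_) (hβ j)
    rw [← Real.cosh_neg, neg_sub, ← hA.apply i j, norm_star]
  have h5 : -(β * ∑ i, ‖v i‖ ^ 2) ≤ ∑ i, ∑ j, (Real.cosh (θ i - θ j) - 1) * q i j := by
    have hS := sum_sum_mul_mul_le hb_nonneg hβ hcol (fun i => ‖v i‖)
    have hterm : ∀ i j, -((Real.cosh (θ i - θ j) - 1) * ‖A i j‖ * (‖v i‖ * ‖v j‖)) ≤
        (Real.cosh (θ i - θ j) - 1) * q i j := by
      intro i j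
      have hq : |q i j| ≤ ‖v i‖ * ‖A i j‖ * ‖v j‖ := by
        refine (Complex.abs_re_le_norm _).trans ?_
        rw [norm_mul, norm_mul, norm_star]
      have hc : 0 ≤ Real.cosh (θ i - θ j) - 1 := by linarith [Real.one_le_cosh (θ i - θ j)]
      have := neg_abs_le (q i j)
      nlinarith
    calc -(β * ∑ i, ‖v i‖ ^ 2)
        ≤ -∑ i, ∑ j, (Real.cosh (θ i - θ j) - 1) * ‖A i j‖ * (‖v i‖ * ‖v j‖) := by linarith
      _ = ∑ i, ∑ j, -((Real.cosh (θ i - θ j) - 1) * ‖A i j‖ * (‖v i‖ * ‖v j‖)) := by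
          rw [← Finset.sum_neg_distrib]
          exact Finset.sum_congr rfl fun i _ => (Finset.sum_neg_distrib _).symm
      _ ≤ ∑ i, ∑ j, (Real.cosh (θ i - θ j) - 1) * q i j :=
          Finset.sum_le_sum fun i _ => Finset.sum_le_sum fun j _ => hterm i j
  rw [h1, h2, h3]
  linarith

omit [DecidableEq ι] in
/-- `Re(v† D†D v) = ‖Dv‖² ≥ 0`. -/
theorem re_quadForm_conjTranspose_mul_self_nonneg {κ : Type*} [Fintype κ] (D : Matrix κ ι ℂ)
    (v : ι → ℂ) : 0 ≤ (star v ⬝ᵥ (Dᴴ * D).mulVec v).re := by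
  rw [← Matrix.mulVec_mulVec, Matrix.dotProduct_mulVec, Matrix.vecMul_conjTranspose, star_star,
    dotProduct, Complex.re_sum]
  refine Finset.sum_nonneg fun i _ => ?_
  rw [Pi.star_apply, Complex.star_def, ← Complex.normSq_eq_conj_mul_self, Complex.ofReal_re]
  exact Complex.normSq_nonneg _

/-- **Davies' exponential-weight bound for the heat kernel of `D†D`.**  Let `d` be a pseudo-metric on
the index set (zero on the diagonal, symmetric, triangle inequality), suppose `D†D` has range `R`
(`(D†D)_{ij} = 0` whenever `d(i,j) > R`) and row sums `Σ_j ‖(D†D)_{ij}‖ ≤ h`.  Then for all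
`λ, t ≥ 0` and all entries,
`|e^{−t D†D}(x, y)| ≤ exp(−λ d(x,y) + t·h·(cosh(λR) − 1))`. -/
theorem davies_exp_entry_bound {κ : Type*} [Fintype κ] (D : Matrix κ ι ℂ) (d : ι → ι → ℕ)
    (hd0 : ∀ i, d i i = 0) (hds : ∀ i j, d i j = d j i) (hdt : ∀ i j k, d i k ≤ d i j + d j k)
    {R : ℕ} (hR : ∀ i j, R < d i j → (Dᴴ * D) i j = 0)
    {h : ℝ} (hh : ∀ i, ∑ j, ‖(Dᴴ * D) i j‖ ≤ h)
    {lam t : ℝ} (hlam : 0 ≤ lam) (ht : 0 ≤ t) (x y : ι) :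
    ‖(exp (-(t : ℂ) • (Dᴴ * D))) x y‖ ≤
      Real.exp (-(lam * d x y) + t * (h * (Real.cosh (lam * R) - 1))) := by
  set A := Dᴴ * D with hA_def
  have hA : A.IsHermitian := Matrix.isHermitian_conjTranspose_mul_self D
  have hpos : ∀ v : ι → ℂ, 0 ≤ (star v ⬝ᵥ A.mulVec v).re :=
    re_quadForm_conjTranspose_mul_self_nonneg D
  set θ : ι → ℝ := fun k => lam * d k y with hθ_def
  set β : ℝ := h * (Real.cosh (lam * R) - 1) with hβ_def
  have hβ : ∀ i, ∑ j, (Real.cosh (θ i - θ j) - 1) * ‖A i j‖ ≤ β := by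
    intro i
    have hterm : ∀ j, (Real.cosh (θ i - θ j) - 1) * ‖A i j‖ ≤
        (Real.cosh (lam * R) - 1) * ‖A i j‖ := by
      intro j
      by_cases hij : A i j = 0
      · simp [hij]
      · have hdR : d i j ≤ R := not_lt.mp fun hlt => hij (hR i j hlt)
        refine mul_le_mul_of_nonneg_right (sub_le_sub_right ?_ 1) (norm_nonneg _)
        rw [Real.cosh_le_cosh, abs_of_nonneg (by positivity : 0 ≤ lam * R)]
        have h1 : |θ i - θ j| ≤ lam * d i j := by
          simp only [hθ_def]
          rw [← mul_sub, abs_mul, abs_of_nonneg hlam]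
          refine mul_le_mul_of_nonneg_left ?_ hlam
          rw [abs_sub_le_iff]
          constructor
          · have h' : (d i y : ℝ) ≤ d i j + d j y := by exact_mod_cast hdt i j y
            linarith
          · have h' : (d j y : ℝ) ≤ d j i + d i y := by exact_mod_cast hdt j i y
            rw [hds j i] at h'
            linarith
        exact h1.trans (mul_le_mul_of_nonneg_left (by exact_mod_cast hdR) hlam)
    calc ∑ j, (Real.cosh (θ i - θ j) - 1) * ‖A i j‖
        ≤ ∑ j, (Real.cosh (lam * R) - 1) * ‖A i j‖ := Finset.sum_le_sum fun j _ => hterm j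
      _ = (Real.cosh (lam * R) - 1) * ∑ j, ‖A i j‖ := by rw [Finset.mul_sum]
      _ ≤ (Real.cosh (lam * R) - 1) * h :=
          mul_le_mul_of_nonneg_left (hh i) (by linarith [Real.one_le_cosh (lam * R)])
      _ = β := by rw [hβ_def]; ring
  -- numerical range of the conjugated generator `B = W A W⁻¹`
  set W : Matrix ι ι ℂ := Matrix.diagonal fun i => ((Real.exp (θ i) : ℝ) : ℂ) with hW_def
  set W' : Matrix ι ι ℂ := Matrix.diagonal fun i => ((Real.exp (-θ i) : ℝ) : ℂ) with hW'_def
  set B := W * A * W' with hB_def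
  have hB : ∀ v : ι → ℂ, -(β * ∑ i, ‖v i‖ ^ 2) ≤ (star v ⬝ᵥ B.mulVec v).re :=
    fun v => re_quadForm_weight_conj_ge hA hpos θ hβ v
  have hnorm := opNorm_toEuclideanCLM_exp_le B hB ht
  -- conjugating the exponential
  let U : (Matrix ι ι ℂ)ˣ := ⟨W, W', weight_mul_weight_neg θ, weight_neg_mul_weight θ⟩
  have hconj : exp (-(t : ℂ) • A) = W' * exp (-(t : ℂ) • B) * W := by
    have e1 : (U : Matrix ι ι ℂ) * (-(t : ℂ) • A) * ((U⁻¹ : (Matrix ι ι ℂ)ˣ) : Matrix ι ι ℂ) =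
        -(t : ℂ) • B := by
      rw [hB_def, Matrix.mul_smul, Matrix.smul_mul]; rfl
    have e2 := Matrix.exp_units_conj U (-(t : ℂ) • A)
    rw [e1] at e2
    rw [e2]
    change exp (-(t : ℂ) • A) = W' * (W * exp (-(t : ℂ) • A) * W') * W
    rw [← mul_assoc, ← mul_assoc, hW_def, hW'_def, weight_neg_mul_weight, one_mul, mul_assoc,
      weight_neg_mul_weight, mul_one]
  have hentry : (exp (-(t : ℂ) • A)) x y =
      ((Real.exp (-θ x) : ℝ) : ℂ) * (exp (-(t : ℂ) • B)) x y * ((Real.exp (θ y) : ℝ) : ℂ) := by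
    rw [hconj, hW_def, hW'_def, Matrix.mul_diagonal, Matrix.diagonal_mul]
  have hθy : θ y = 0 := by simp [hθ_def, hd0]
  have hθx : θ x = lam * d x y := rfl
  rw [hentry, hθy, Real.exp_zero, Complex.ofReal_one, mul_one, norm_mul, Complex.norm_real,
    Real.norm_eq_abs, abs_of_pos (Real.exp_pos _), hθx]
  calc Real.exp (-(lam * d x y)) * ‖(exp (-(t : ℂ) • B)) x y‖
      ≤ Real.exp (-(lam * d x y)) * Real.exp (β * t) := by
        gcongr
        exact (norm_entry_le_opNorm_toEuclideanCLM _ x y).trans hnorm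
    _ = Real.exp (-(lam * ↑(d x y)) + t * (h * (Real.cosh (lam * ↑R) - 1))) := by
        rw [← Real.exp_add, hβ_def]; ring_nf

end Weighted

end Summit.QuantumFields.QCD.Theorems.HeatSlicedQuarksDaviesGaffney

/-! ## The closing theorem -/

namespace Summit.QuantumFields.QCD.Theorems

open Literature.Probability.LatticeModels (TorusSite)
open Literature.MathematicalPhysics.QuantumFieldTheory
open Literature.MathematicalPhysics.QuantumLattice
open HeatSlicedQuarksDaviesGaffney NormedSpace
open scoped Matrix

/-- Elementary: `cosh(2x) − 1 ≤ 18 x²` for `0 ≤ x ≤ 1`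
(`cosh y ≤ e^{y²/2}`, `e^s − 1 ≤ s e^s`, `e² < 9`). -/
theorem cosh_two_mul_sub_one_le {x : ℝ} (hx0 : 0 ≤ x) (hx1 : x ≤ 1) :
    Real.cosh (2 * x) - 1 ≤ 18 * x ^ 2 := by
  have h1 : Real.cosh (2 * x) ≤ Real.exp (2 * x ^ 2) := by
    have := Real.cosh_le_exp_half_sq (2 * x)
    calc Real.cosh (2 * x) ≤ Real.exp ((2 * x) ^ 2 / 2) := this
      _ = Real.exp (2 * x ^ 2) := by ring_nf
  have h2 : Real.exp (2 * x ^ 2) - 1 ≤ 2 * x ^ 2 * Real.exp (2 * x ^ 2) := by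
    have h := Real.add_one_le_exp (-(2 * x ^ 2))
    have hpos := Real.exp_pos (2 * x ^ 2)
    have hmul : Real.exp (-(2 * x ^ 2)) * Real.exp (2 * x ^ 2) = 1 := by
      rw [← Real.exp_add]; simp
    nlinarith
  have h3 : Real.exp (2 * x ^ 2) ≤ 9 := by
    have hx2 : 2 * x ^ 2 ≤ 1 + 1 := by nlinarith
    calc Real.exp (2 * x ^ 2) ≤ Real.exp (1 + 1) := Real.exp_le_exp.mpr hx2
      _ = Real.exp 1 * Real.exp 1 := Real.exp_add 1 1
      _ ≤ 3 * 3 := mul_le_mul Real.exp_one_lt_three.le Real.exp_one_lt_three.le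
          (Real.exp_pos 1).le (by norm_num)
      _ = 9 := by norm_num
  have hx2 : 0 ≤ 2 * x ^ 2 := by positivity
  nlinarith

/-- The exponent bookkeeping of Davies' method: with `λ = a·d/(t+d)`, `a = 1/(36 h)` (`h ≥ 1`),
`−λ d + t·h·(cosh 2λ − 1) ≤ −(a/2)·d²/(t+d)` for all `t ≥ 0`, `d ∈ ℕ`. -/
theorem davies_exponent_le {h : ℝ} (hh : 1 ≤ h) {t : ℝ} (ht : 0 ≤ t) (d : ℕ) :
    -(1 / (36 * h) * d / (t + d) * d) + t * (h * (Real.cosh (1 / (36 * h) * d / (t + d) * 2) - 1)) ≤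
      -(1 / (36 * h) / 2 * (d : ℝ) ^ 2 / (t + d)) := by
  set a : ℝ := 1 / (36 * h) with ha
  have ha0 : 0 < a := by rw [ha]; positivity
  have ha1 : a ≤ 1 := by
    rw [ha, div_le_one (by positivity)]; linarith
  rcases Nat.eq_zero_or_pos d with rfl | hd
  · simp
  · have hd' : (0 : ℝ) < d := by exact_mod_cast hd
    have htd : 0 < t + d := by linarith
    set s : ℝ := d / (t + d) with hs
    have hs0 : 0 ≤ s := by positivity
    have hs1 : s ≤ 1 := by rw [hs, div_le_one htd]; linarith
    have hlam : a * d / (t + d) = a * s := by rw [hs]; ring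
    have hl0 : 0 ≤ a * s := by positivity
    have hl1 : a * s ≤ 1 := by nlinarith
    have hcosh : Real.cosh (a * s * 2) - 1 ≤ 18 * (a * s) ^ 2 := by
      rw [mul_comm (a * s) 2]; exact cosh_two_mul_sub_one_le hl0 hl1
    have hts : t * s ≤ d := by
      rw [hs, mul_div_assoc']
      rw [div_le_iff₀ htd]
      nlinarith
    rw [hlam]
    have hkey : t * (h * (Real.cosh (a * s * 2) - 1)) ≤ a * s * d / 2 := by
      calc t * (h * (Real.cosh (a * s * 2) - 1)) ≤ t * (h * (18 * (a * s) ^ 2)) := by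
            gcongr
        _ = (18 * h * a) * (a * s) * (t * s) := by ring
        _ ≤ (18 * h * a) * (a * s) * d := by gcongr
        _ = a * s * d / 2 := by rw [ha]; field_simp; ring
    have hfin : a / 2 * (d : ℝ) ^ 2 / (t + d) = a * s * d / 2 := by rw [hs]; ring
    rw [hfin]
    linarith

/-- **U-uniform Davies–Gaffney bound for the Wilson heat kernel** (item stmt-QuantumFields-8873,
support `DaviesGaffneyWilson` of route `HeatSlicedQuarks`): there are constants `C, c > 0` such that for
every torus side `L`, every `SU(3)` lattice gauge field `U`, every bare mass `m ∈ [−1, 1]`, every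
`t ≥ 0` and all colour–spin indices,
`|e^{−t H_U}((x,a,α),(y,b,β))| ≤ C·exp(−c·d²/(t + d))`, `d = torusDist x y`, `H_U = D_W† D_W`.
Proof: Davies' exponential-weight method (`davies_exp_entry_bound`) for the positive matrix
`H_U = D†D`, which has range `2` in the torus distance and row sums of `|H_U|` at most `101²`
uniformly in `U` (unitary links, bounded `γ`-matrices), with the weight slope `λ = a·d/(t+d)`;
constants `C = 1`, `c = a/2`, `a = 1/(36·101²)`. -/
theorem DaviesGaffneyWilson_proof :
    Summit.QuantumFields.QCD.Theses.HeatSlicedQuarks.DaviesGaffneyWilson := by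
  unfold Summit.QuantumFields.QCD.Theses.HeatSlicedQuarks.DaviesGaffneyWilson
  set h0 : ℝ := (101 : ℝ) ^ 2 with hh0
  have hh1 : (1 : ℝ) ≤ h0 := by rw [hh0]; norm_num
  refine ⟨1, 1 / (36 * h0) / 2, by positivity, ?_⟩
  intro L _ U m hm t ht x y a b α β
  set ρ := fundamentalRep (Fin 3) with hρ_def
  have hρ : ∀ g, ρ g ∈ Matrix.unitaryGroup (Fin 3) ℂ := fundamentalRep_mem_unitaryGroup
  set D := wilsonDirac ρ U m 1 with hD
  -- the pseudo-metric on site × colour × spin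
  let dist : TorusSite 4 L × Fin 3 × Fin 4 → TorusSite 4 L × Fin 3 × Fin 4 → ℕ :=
    fun p q => torusDist p.1 q.1
  have hd0 : ∀ p, dist p p = 0 := fun p => torusDist_self p.1
  have hds : ∀ p q, dist p q = dist q p := fun p q => torusDist_comm' p.1 q.1
  have hdt : ∀ p q k, dist p k ≤ dist p q + dist q k := fun p q k => torusDist_triangle' p.1 q.1 k.1
  have hR : ∀ p q, 2 < dist p q → (Dᴴ * D) p q = 0 := fun p q hpq =>
    conjTranspose_mul_wilsonDirac_apply_eq_zero ρ U m 1 p q hpq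
  have hh : ∀ p, ∑ q, ‖(Dᴴ * D) p q‖ ≤ h0 := by
    intro p
    refine (sum_norm_conjTranspose_mul_wilsonDirac_le ρ hρ U m 1 p).trans ?_
    have hm4 : |m + 4 * 1| ≤ 5 := by
      rw [abs_le]; constructor <;> linarith [hm.1, hm.2]
    have hB : |m + 4 * 1| + 16 * (3 : ℕ) * (|(1 : ℝ)| + 1) ≤ 101 := by
      rw [abs_one]; push_cast; linarith
    have hB0 : 0 ≤ |m + 4 * 1| + 16 * (3 : ℕ) * (|(1 : ℝ)| + 1) := by positivity
    rw [hh0]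
    exact pow_le_pow_left₀ hB0 hB 2
  set dxy : ℕ := torusDist x y with hdxy
  have hlam : 0 ≤ 1 / (36 * h0) * dxy / (t + dxy) := by positivity
  have key := davies_exp_entry_bound D dist hd0 hds hdt hR hh hlam ht (x, a, α) (y, b, β)
  refine key.trans ?_
  rw [one_mul, Real.exp_le_exp]
  have := davies_exponent_le hh1 ht dxy
  convert this using 2
  norm_num

end Summit.QuantumFields.QCD.Theorems
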